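import Literature.NumberTheory.LFunctions.RudnickSarnakCycles
import Literature.NumberTheory.LFunctions.RudnickSarnakStrata
import HarnessLib

/-!
# Refinements of a set partition splitting each block in at most two

Rudnick–Sarnak, Duke Math. J. **81** (1996), proof of Proposition 4.1 (pp. 308–309): the
pairs `(Q, F)` of set partitions with `Q ≤ F` such that every block of `F` is a union of at
most two blocks of `Q` — these index the marked set partitions `(Q, b)` reducing to `F`
("a marking of `Q` is a choice of `r ≥ 0` pairs of subsets", and `(Q, b) → F`) — are encoded by
the subsets `A` of the non-minimal elements of the blocks of `F`: `A ↦ Q_A`, the refinement of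
`F` obtained by splitting each block `C` into `C ∩ A` and `C ∖ A` (`refineBy`), with inverse
`Q ↦` the set of elements whose `Q`-block does not contain the least element of their `F`-block
(`demoted`). Under this encoding the Möbius function (4.4) of `Q_A` factors over the blocks of
`F` (`partitionMoebius_refineBy`), and products over blocks of sums over subsets of the blocks
distribute (`prod_sum_powerset_eq_sum_powerset_prod`), which is the factorisation identity (4.25).

## Contents

* `freeSet`, `refineBy`, `Adm`, `demoted`; the bijection `Adm F ≃ 𝒫(freeSet F)`
  (`sum_adm_eq_sum_powerset`).
* `filter_parts_refineBy_subset`, `partitionMoebius_refineBy` (μ of `Q_A` as a product over the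
  blocks of `F`), `prod_sum_powerset_eq_sum_powerset_prod` (distributivity).

## References

* Z. Rudnick, P. Sarnak, Duke Math. J. 81 (1996), (4.4), proof of Prop. 4.1, (4.23)–(4.26).
-/

noncomputable section

open Finset

namespace Literature.NumberTheory.LFunctions

namespace RudnickSarnak

variable {n : ℕ} (F : Finpartition (univ : Finset (Fin n)))

/-! ## The subset encoding of admissible refinements -/

/-- The non-minimal elements of the blocks of `F` (as a `Finset`; the indices `Free F`).
[folklore] -/
def freeSet : Finset (Fin n) := univ.filter fun a ↦ ¬IsRep F a

/-- [folklore] -/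
theorem mem_freeSet {a : Fin n} : a ∈ freeSet F ↔ ¬IsRep F a := by simp [freeSet]

/-- The refinement `Q_A` of `F` along a set `A`: each block `C` is split into `C ∩ A` and `C ∖ A`
(the kernel partition of `a ↦ (F.part a, [a ∈ A])`). [cite: RudnickSarnak1996, proof of Prop 4.1] -/
def refineBy (A : Finset (Fin n)) : Finpartition (univ : Finset (Fin n)) :=
  kerPart fun a ↦ (F.part a, decide (a ∈ A))

/-- The block relation of `Q_A`. [folklore] -/
theorem mem_part_refineBy {A : Finset (Fin n)} {a b : Fin n} :
    b ∈ (refineBy F A).part a ↔ F.part a = F.part b ∧ (a ∈ A ↔ b ∈ A) := by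
  unfold refineBy
  rw [mem_part_kerPart, Prod.mk.injEq]
  simp only [decide_eq_decide]

/-- `Q_A` refines `F`. [folklore] -/
theorem part_refineBy_subset (A : Finset (Fin n)) (a : Fin n) : (refineBy F A).part a ⊆ F.part a := by
  intro b hb
  rw [(mem_part_refineBy F).1 hb |>.1]
  exact F.mem_part_self.2 (mem_univ b)

/-- The admissible refinements of `F`: set partitions `Q ≤ F` such that every block of `F` meets
at most two blocks of `Q` (among three elements of a block of `F`, two share a block of `Q`).
[cite: RudnickSarnak1996, proof of Prop 4.1] -/
def Adm : Finset (Finpartition (univ : Finset (Fin n))) :=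
  univ.filter fun Q ↦ (∀ a, Q.part a ⊆ F.part a) ∧
    ∀ a b c, F.part a = F.part b → F.part b = F.part c →
      (Q.part a = Q.part b ∨ Q.part b = Q.part c ∨ Q.part a = Q.part c)

/-- [folklore] -/
theorem mem_adm {Q : Finpartition (univ : Finset (Fin n))} :
    Q ∈ Adm F ↔ (∀ a, Q.part a ⊆ F.part a) ∧
      ∀ a b c, F.part a = F.part b → F.part b = F.part c →
        (Q.part a = Q.part b ∨ Q.part b = Q.part c ∨ Q.part a = Q.part c) := by
  simp [Adm]

/-- The elements demoted by `Q`: those whose `Q`-block does not contain the least element of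
their `F`-block. [cite: RudnickSarnak1996, proof of Prop 4.1] -/
def demoted (Q : Finpartition (univ : Finset (Fin n))) : Finset (Fin n) :=
  univ.filter fun a ↦ rep Q a ≠ rep F a

/-- [folklore] -/
theorem mem_demoted {Q : Finpartition (univ : Finset (Fin n))} {a : Fin n} :
    a ∈ demoted F Q ↔ rep Q a ≠ rep F a := by simp [demoted]

/-- Same block iff same representative. [folklore] -/
theorem part_eq_part_iff_rep_eq (Q : Finpartition (univ : Finset (Fin n))) {a b : Fin n} :
    Q.part a = Q.part b ↔ rep Q a = rep Q b := by
  constructor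
  · intro h
    unfold rep
    congr 1
  · intro h
    have ha : rep Q a ∈ Q.part a := rep_mem Q a
    have hb : rep Q a ∈ Q.part b := h ▸ rep_mem Q b
    rw [← Q.part_eq_of_mem (Q.part_mem.2 (mem_univ a)) ha,
      ← Q.part_eq_of_mem (Q.part_mem.2 (mem_univ b)) hb]

/-- A representative of `F` is a representative of any refinement. [folklore] -/
theorem isRep_of_isRep_of_subset {Q : Finpartition (univ : Finset (Fin n))}
    (hQ : ∀ a, Q.part a ⊆ F.part a) {j : Fin n} (h : IsRep F j) : IsRep Q j := by
  refine le_antisymm (rep_le Q (Q.mem_part_self.2 (mem_univ j))) ?_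
  have h1 : rep F j ≤ rep Q j := rep_le F (hQ j (rep_mem Q j))
  rw [h] at h1
  exact h1

/-- `Q_A` is admissible when `A` avoids the representatives of `F`. [folklore] -/
theorem refineBy_mem_adm (A : Finset (Fin n)) : refineBy F A ∈ Adm F := by
  rw [mem_adm]
  refine ⟨part_refineBy_subset F A, fun a b c hab hbc ↦ ?_⟩
  -- pigeonhole on membership in `A`
  have key : ∀ x y : Fin n, F.part x = F.part y → (x ∈ A ↔ y ∈ A) →
      (refineBy F A).part x = (refineBy F A).part y := by
    intro x y hxy hA'
    have hy : y ∈ (refineBy F A).part x := (mem_part_refineBy F).2 ⟨hxy, hA'⟩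
    exact ((refineBy F A).part_eq_of_mem ((refineBy F A).part_mem.2 (mem_univ x)) hy).symm
  by_cases ha : a ∈ A <;> by_cases hb : b ∈ A <;> by_cases hc : c ∈ A
  · exact Or.inl (key a b hab (by tauto))
  · exact Or.inl (key a b hab (by tauto))
  · exact Or.inr (Or.inr (key a c (hab.trans hbc) (by tauto)))
  · exact Or.inr (Or.inl (key b c hbc (by tauto)))
  · exact Or.inr (Or.inl (key b c hbc (by tauto)))
  · exact Or.inr (Or.inr (key a c (hab.trans hbc) (by tauto)))
  · exact Or.inl (key a b hab (by tauto))
  · exact Or.inl (key a b hab (by tauto))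

/-- The representative of the `Q_A`-block of `a`. [folklore] -/
theorem rep_refineBy_eq_rep_iff {A : Finset (Fin n)} (hA : A ⊆ freeSet F) (a : Fin n) :
    rep (refineBy F A) a = rep F a ↔ a ∉ A := by
  have hrA : rep F a ∉ A := fun h ↦ (mem_freeSet F).1 (hA h) (isRep_rep F a)
  constructor
  · intro h ha
    have : rep (refineBy F A) a ∈ (refineBy F A).part a := rep_mem _ a
    rw [h, mem_part_refineBy] at this
    exact hrA (this.2.1 ha)
  · intro ha
    have hmem : rep F a ∈ (refineBy F A).part a :=
      (mem_part_refineBy F).2 ⟨(part_rep F a).symm, ⟨fun h ↦ absurd h ha, fun h ↦ absurd h hrA⟩⟩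
    refine le_antisymm (rep_le _ hmem) ?_
    exact rep_le F (part_refineBy_subset F A a (rep_mem _ a))

/-- `demoted (Q_A) = A`. [folklore] -/
theorem demoted_refineBy {A : Finset (Fin n)} (hA : A ⊆ freeSet F) : demoted F (refineBy F A) = A := by
  ext a
  rw [mem_demoted, Ne, rep_refineBy_eq_rep_iff F hA, not_not]

/-- For an admissible `Q`, demoted elements are free. [folklore] -/
theorem demoted_subset_freeSet {Q : Finpartition (univ : Finset (Fin n))} (hQ : Q ∈ Adm F) :
    demoted F Q ⊆ freeSet F := by
  intro a ha
  rw [mem_demoted] at ha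
  rw [mem_freeSet]
  intro h
  apply ha
  rw [isRep_of_isRep_of_subset F (mem_adm F |>.1 hQ).1 h, h]

/-- `Q_{demoted Q} = Q` for admissible `Q`. [folklore] -/
theorem refineBy_demoted {Q : Finpartition (univ : Finset (Fin n))} (hQ : Q ∈ Adm F) :
    refineBy F (demoted F Q) = Q := by
  obtain ⟨hsub, htwo⟩ := (mem_adm F).1 hQ
  refine Finpartition.eq_of_forall_mem_part_iff fun a b ↦ ?_
  rw [mem_part_refineBy, mem_demoted, mem_demoted]
  constructor
  · rintro ⟨hF, hD⟩
    have hrF : rep F a = rep F b := by unfold rep; congr 1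
    have hr : rep Q (rep F a) = rep F a := isRep_of_isRep_of_subset F hsub (isRep_rep F a)
    by_cases hda : rep Q a = rep F a
    · -- neither is demoted: both `Q`-representatives are the `F`-representative
      have hdb : rep Q b = rep F b := by
        by_contra h
        exact (hD.2 h) hda
      have : Q.part a = Q.part b := (part_eq_part_iff_rep_eq Q).2 (by rw [hda, hdb, hrF])
      rw [this]
      exact Q.mem_part_self.2 (mem_univ b)
    · -- both demoted: among `a`, `b`, `rep F a` two share a `Q`-block
      have hdb : rep Q b ≠ rep F b := hD.1 hda
      rcases htwo a b (rep F a) hF (hF.symm.trans (part_rep F a).symm) with h | h | h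
      · rw [h]
        exact Q.mem_part_self.2 (mem_univ b)
      · exfalso
        apply hdb
        rw [(part_eq_part_iff_rep_eq Q).1 h, hr, hrF]
      · exfalso
        apply hda
        rw [(part_eq_part_iff_rep_eq Q).1 h, hr]
  · intro hb
    have hab : Q.part b = Q.part a := Q.part_eq_of_mem (Q.part_mem.2 (mem_univ a)) hb
    have hF : F.part b = F.part a := F.part_eq_of_mem (F.part_mem.2 (mem_univ a)) (hsub a hb)
    refine ⟨hF.symm, ?_⟩
    have hrQ : rep Q a = rep Q b := (part_eq_part_iff_rep_eq Q).1 hab.symm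
    have hrF : rep F a = rep F b := (part_eq_part_iff_rep_eq F).1 hF.symm
    rw [hrQ, hrF]

/-- **`Adm F ≃ 𝒫(freeSet F)`** as a reindexing of sums: `Q ↦ demoted Q`, `A ↦ Q_A`.
[cite: RudnickSarnak1996, proof of Prop 4.1] -/
theorem sum_adm_eq_sum_powerset {M : Type*} [AddCommMonoid M]
    (f : Finpartition (univ : Finset (Fin n)) → M) :
    ∑ Q ∈ Adm F, f Q = ∑ A ∈ (freeSet F).powerset, f (refineBy F A) := by
  refine Finset.sum_nbij' (demoted F) (refineBy F) ?_ ?_ ?_ ?_ ?_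
  · intro Q hQ
    exact Finset.mem_powerset.2 (demoted_subset_freeSet F hQ)
  · intro A _
    exact refineBy_mem_adm F A
  · intro Q hQ
    exact refineBy_demoted F hQ
  · intro A hA
    exact demoted_refineBy F (Finset.mem_powerset.1 hA)
  · intro Q hQ
    rw [refineBy_demoted F hQ]

/-! ## The blocks of `Q_A` and its Möbius function -/

/-- Membership in a block of `F` in terms of `part`. [folklore] -/
theorem mem_part_iff_part_eq (F' : Finpartition (univ : Finset (Fin n))) {a b : Fin n} :
    b ∈ F'.part a ↔ F'.part b = F'.part a :=
  ⟨fun h ↦ F'.part_eq_of_mem (F'.part_mem.2 (mem_univ a)) h,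
    fun h ↦ h ▸ F'.mem_part_self.2 (mem_univ b)⟩

/-- The `Q_A`-block of `a ∈ C`: `C ∩ A` or `C ∖ A`. [folklore] -/
theorem part_refineBy_eq {A : Finset (Fin n)} {C : Finset (Fin n)} (hC : C ∈ F.parts) {a : Fin n}
    (ha : a ∈ C) : (refineBy F A).part a = if a ∈ A then C ∩ A else C \ A := by
  have hCa : F.part a = C := F.part_eq_of_mem hC ha
  ext b
  rw [mem_part_refineBy]
  split_ifs with h
  · rw [Finset.mem_inter, ← hCa, eq_comm, ← mem_part_iff_part_eq]
    tauto
  · rw [Finset.mem_sdiff, ← hCa, eq_comm, ← mem_part_iff_part_eq]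
    tauto

/-- The blocks of `Q_A` inside a block `C` of `F`: `{C}` if `C ∩ A = ∅`, else `{C ∩ A, C ∖ A}`
(for `A` avoiding the representatives, so that `C ∖ A ≠ ∅`). [cite: RudnickSarnak1996, proof of Prop 4.1] -/
theorem filter_parts_refineBy_subset {A : Finset (Fin n)} (hA : A ⊆ freeSet F) {C : Finset (Fin n)}
    (hC : C ∈ F.parts) :
    (refineBy F A).parts.filter (· ⊆ C) = if C ∩ A = ∅ then {C} else {C ∩ A, C \ A} := by
  obtain ⟨r, hr⟩ := F.nonempty_of_mem_parts hC
  -- the representative of `C` is not in `A`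
  set r₀ := rep F r with hr₀
  have hr₀C : r₀ ∈ C := by rw [hr₀, ← F.part_eq_of_mem hC hr]; exact rep_mem F r
  have hr₀A : r₀ ∉ A := fun h ↦ (mem_freeSet F).1 (hA h) (isRep_rep F r)
  ext t
  simp only [Finset.mem_filter]
  constructor
  · rintro ⟨ht, htC⟩
    obtain ⟨a, ha⟩ := (refineBy F A).nonempty_of_mem_parts ht
    have haC : a ∈ C := htC ha
    have hta : (refineBy F A).part a = t := (refineBy F A).part_eq_of_mem ht ha
    rw [← hta, part_refineBy_eq F hC haC]
    by_cases haA : a ∈ A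
    · have hne : C ∩ A ≠ ∅ := Finset.ne_empty_of_mem (Finset.mem_inter.2 ⟨haC, haA⟩)
      simp [haA, hne]
    · by_cases hCA : C ∩ A = ∅
      · have : C \ A = C := by
          rw [Finset.sdiff_eq_self_iff_disjoint, Finset.disjoint_iff_inter_eq_empty]
          exact hCA
        simp [haA, hCA, this]
      · simp [haA, hCA]
  · intro ht
    by_cases hCA : C ∩ A = ∅
    · rw [if_pos hCA, Finset.mem_singleton] at ht
      subst ht
      have h1 : (refineBy F A).part r₀ = t := by
        rw [part_refineBy_eq F hC hr₀C, if_neg hr₀A, Finset.sdiff_eq_self_iff_disjoint,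
          Finset.disjoint_iff_inter_eq_empty]
        exact hCA
      exact ⟨h1 ▸ (refineBy F A).part_mem.2 (mem_univ r₀), subset_rfl⟩
    · rw [if_neg hCA, Finset.mem_insert, Finset.mem_singleton] at ht
      rcases ht with rfl | rfl
      · obtain ⟨a, ha⟩ := Finset.nonempty_iff_ne_empty.2 hCA
        obtain ⟨haC, haA⟩ := Finset.mem_inter.1 ha
        have h1 : (refineBy F A).part a = C ∩ A := by rw [part_refineBy_eq F hC haC, if_pos haA]
        exact ⟨h1 ▸ (refineBy F A).part_mem.2 (mem_univ a), Finset.inter_subset_left⟩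
      · have h1 : (refineBy F A).part r₀ = C \ A := by rw [part_refineBy_eq F hC hr₀C, if_neg hr₀A]
        exact ⟨h1 ▸ (refineBy F A).part_mem.2 (mem_univ r₀), Finset.sdiff_subset⟩

/-- The blocks of a refinement grouped by the blocks of `F`. [folklore] -/
theorem prod_parts_eq_prod_prod_filter {M : Type*} [CommMonoid M] {Q : Finpartition (univ : Finset (Fin n))}
    (hQ : ∀ a, Q.part a ⊆ F.part a) (g : Finset (Fin n) → M) :
    ∏ t ∈ Q.parts, g t = ∏ C ∈ F.parts, ∏ t ∈ Q.parts.filter (· ⊆ C), g t := by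
  have hunion : Q.parts = F.parts.biUnion (fun C ↦ Q.parts.filter (· ⊆ C)) := by
    ext t
    simp only [Finset.mem_biUnion, Finset.mem_filter]
    constructor
    · intro ht
      obtain ⟨a, ha⟩ := Q.nonempty_of_mem_parts ht
      refine ⟨F.part a, F.part_mem.2 (mem_univ a), ht, ?_⟩
      rw [← Q.part_eq_of_mem ht ha]
      exact hQ a
    · rintro ⟨C, -, ht, -⟩
      exact ht
  have hdisj : (F.parts : Set (Finset (Fin n))).PairwiseDisjoint
      (fun C ↦ Q.parts.filter (· ⊆ C)) := by
    intro C hC C' hC' hne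
    rw [Function.onFun, Finset.disjoint_left]
    intro t ht ht'
    obtain ⟨htQ, htC⟩ := Finset.mem_filter.1 ht
    obtain ⟨-, htC'⟩ := Finset.mem_filter.1 ht'
    obtain ⟨a, ha⟩ := Q.nonempty_of_mem_parts htQ
    exact hne (F.eq_of_mem_parts hC hC' (htC ha) (htC' ha))
  conv_lhs => rw [hunion]
  rw [Finset.prod_biUnion hdisj]

/-- **The Möbius function of `Q_A` factors over the blocks of `F`** (by (4.4)):
`μ(O, Q_A) = ∏_{C ∈ F} (μ_C if C ∩ A = ∅, else μ_{C∩A} μ_{C∖A})`.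
[cite: RudnickSarnak1996, (4.4) and (4.25)] -/
theorem partitionMoebius_refineBy {A : Finset (Fin n)} (hA : A ⊆ freeSet F) :
    partitionMoebius (refineBy F A) =
      ∏ C ∈ F.parts, (if C ∩ A = ∅ then blockMoebius C else blockMoebius (C ∩ A) * blockMoebius (C \ A)) := by
  rw [partitionMoebius_eq_prod_holds (refineBy F A),
    prod_parts_eq_prod_prod_filter F (part_refineBy_subset F A) (fun t ↦ (-1) ^ (#t - 1) * ((#t - 1).factorial : ℤ))]
  refine Finset.prod_congr rfl fun C hC ↦ ?_
  rw [filter_parts_refineBy_subset F hA hC]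
  split_ifs with h
  · rw [Finset.prod_singleton, blockMoebius]
  · rw [Finset.prod_pair, blockMoebius, blockMoebius]
    intro heq
    obtain ⟨a, ha⟩ := Finset.nonempty_iff_ne_empty.2 h
    have : a ∈ C \ A := heq ▸ ha
    exact (Finset.mem_sdiff.1 this).2 (Finset.mem_inter.1 ha).2

/-! ## Distributivity over the blocks -/

/-- **Products over the blocks of `F` of sums over subsets of the free part of each block are sums
over subsets of the free set** (the expansion behind the factorisation identity (4.25)):
`∏_{C ∈ F} ∑_{B ⊆ C ∩ freeSet F} φ_C(B) = ∑_{A ⊆ freeSet F} ∏_{C ∈ F} φ_C(A ∩ C)`.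
[cite: RudnickSarnak1996, (4.25)] -/
theorem prod_sum_powerset_eq_sum_powerset_prod {R : Type*} [CommSemiring R]
    (φ : Finset (Fin n) → Finset (Fin n) → R) :
    ∏ C ∈ F.parts, ∑ B ∈ (C ∩ freeSet F).powerset, φ C B =
      ∑ A ∈ (freeSet F).powerset, ∏ C ∈ F.parts, φ C (A ∩ C) := by
  classical
  rw [Finset.prod_sum]
  -- `p ↦ ⋃ p`, `A ↦ (C ↦ A ∩ C)`
  refine Finset.sum_nbij' (fun p ↦ F.parts.attach.biUnion fun C ↦ p C.1 C.2)
    (fun A C _ ↦ A ∩ C) ?_ ?_ ?_ ?_ ?_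
  · intro p hp
    rw [Finset.mem_pi] at hp
    rw [Finset.mem_powerset]
    intro x hx
    obtain ⟨C, -, hx⟩ := Finset.mem_biUnion.1 hx
    exact (Finset.mem_inter.1 (Finset.mem_powerset.1 (hp C.1 C.2) hx)).2
  · intro A hA
    rw [Finset.mem_pi]
    intro C hC
    rw [Finset.mem_powerset]
    intro x hx
    exact Finset.mem_inter.2 ⟨(Finset.mem_inter.1 hx).2, Finset.mem_powerset.1 hA (Finset.mem_inter.1 hx).1⟩
  · intro p hp
    rw [Finset.mem_pi] at hp
    funext C hC
    ext x
    simp only [Finset.mem_inter, Finset.mem_biUnion, Finset.mem_attach, true_and, Subtype.exists]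
    constructor
    · rintro ⟨⟨C', hC', hx⟩, hxC⟩
      have hxC' : x ∈ C' := (Finset.mem_inter.1 (Finset.mem_powerset.1 (hp C' hC') hx)).1
      have : C' = C := F.eq_of_mem_parts hC' hC hxC' hxC
      subst this
      exact hx
    · intro hx
      exact ⟨⟨C, hC, hx⟩, (Finset.mem_inter.1 (Finset.mem_powerset.1 (hp C hC) hx)).1⟩
  · intro A _
    ext x
    simp only [Finset.mem_biUnion, Finset.mem_attach, true_and, Subtype.exists, Finset.mem_inter]
    constructor
    · rintro ⟨C, -, hx, -⟩
      exact hx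
    · intro hx
      exact ⟨F.part x, F.part_mem.2 (mem_univ x), hx, F.mem_part_self.2 (mem_univ x)⟩
  · intro p hp
    rw [Finset.mem_pi] at hp
    rw [← Finset.prod_attach F.parts (fun C ↦ φ C (F.parts.attach.biUnion (fun C ↦ p C.1 C.2) ∩ C))]
    refine Finset.prod_congr rfl fun C _ ↦ ?_
    congr 1
    ext x
    simp only [Finset.mem_inter, Finset.mem_biUnion, Finset.mem_attach, true_and, Subtype.exists]
    constructor
    · intro hx
      exact ⟨⟨C.1, C.2, hx⟩, (Finset.mem_inter.1 (Finset.mem_powerset.1 (hp C.1 C.2) hx)).1⟩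
    · rintro ⟨⟨C', hC', hx⟩, hxC⟩
      have hxC' : x ∈ C' := (Finset.mem_inter.1 (Finset.mem_powerset.1 (hp C' hC') hx)).1
      have : C' = C.1 := F.eq_of_mem_parts hC' C.2 hxC' hxC
      subst this
      exact hx

end RudnickSarnak

end Literature.NumberTheory.LFunctions

end
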